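import Literature.NumberTheory.EllipticCurves.TorsionFrobeniusProofs
import Literature.NumberTheory.EllipticCurves.PAdicLFunctionIntegralityProofs
import Literature.RepresentationTheory.FiniteGroups.InvariantLineOfFixedVectors
import HarnessLib

/-!
# `E[p]` is reducible when all Frobenius traces are Eisenstein mod `p` — proof, and the
# integrality `L_p(E, T) ∈ Λ` for `E[p]` irreducible (Greenberg–Vatsal 2000, Prop. 3.7) — proof

Topic `NumberTheory/EllipticCurves` (trunk T-ELLARITH); `Proofs` companion (theorems only) of
`Literature.NumberTheory.EllipticCurves.ModPReducibility`, whose named fact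
`Literature.NumberTheory.EllipticCurves.not_irreducible_of_frobeniusTrace_congr` — if `a_ℓ(E) ≡ ℓ + 1 (mod p)` for every prime
`ℓ ≠ p` of good reduction then the `Γ_ℚ`-module `E[p]` is reducible (Darmon–Diamond–Taylor 1995,
Prop. 2.6(b) with 2.8(a), 2.11(a): Chebotarev + Brauer–Nesbitt; Katz 1981, Thm. 2) — is the
Galois-theoretic input of the integrality `L_p(E, T) ∈ Λ` for `E[p]` irreducible
(Greenberg–Vatsal 2000, Prop. 3.7; `PAdicLFunction.padicLFunction_mem_integral`, reduced to that
fact in `PAdicLFunctionIntegralityProofs.padicLFunction_mem_integral_of`).  Both are **proved**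
here, unconditionally:

* `Literature.NumberTheory.EllipticCurves.not_irreducible_of_forall_exists_smul_eq` — if every `σ ∈ Γ_ℚ` fixes a non-zero point of
  `E[p]` then `E[p]` is reducible: `E[p]` is an `𝔽_p`-plane (`#E[p] = p²`,
  `card_torsionPoints_eq_sq_holds`, Silverman III.6.4(b)) and a subgroup of `GL₂(𝔽_p)` all of
  whose elements have the eigenvalue `1` fixes a line
  (`Representation.exists_stable_addSubgroup_of_natCard_eq_sq`, file
  `RepresentationTheory/FiniteGroups/InvariantLineOfFixedVectors`: the unipotent-or-abelian
  dichotomy).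
* `Literature.NumberTheory.EllipticCurves.not_irreducible_of_frobeniusTrace_congr_holds` — **the named fact**.  Assume
  `p ∣ a_ℓ - ℓ - 1`, i.e. `p ∣ #Ẽ(𝔽_ℓ)` (`dvd_frobeniusTrace_sub_iff`), for all good `ℓ ≠ p`, and
  let `σ ∈ Γ_ℚ`.  By **Frobenius' density theorem** (division form, proved in the tree;
  `exists_frobenius_pow_smul_eq_geomTorsion`, file `TorsionFrobeniusProofs`) `σ` acts on `E[p]` as
  a power `φ^j` of an arithmetic Frobenius `φ` at a prime of `\bar ℤ` above a prime `ℓ` outside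
  `S = {p} ∪ {ℓ ∣ Δ_min(E)}` — so `ℓ ≠ p` is good (`hasGoodReductionAtPrime_of_not_dvd`) — and by
  the **reduction of torsion** (`exists_frobenius_smul_eq_of_dvd_reductionPointCount_holds`, loc.
  cit.: Silverman VII.3.1(b), VII.2.1, VII.4.1(a), III.6.4(b)) `φ` fixes a non-zero `P ∈ E[p]`;
  then so does `φ^j`, i.e. `σ`.  Only the eigenvalue `1` of Frobenius is used — neither
  `det ρ̄_{E,p} = ε̄` (Weil pairing) nor traces (Brauer–Nesbitt) — and Chebotarev's theorem is
  replaced by Frobenius' (1896).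
* `Literature.NumberTheory.EllipticCurves.padicLFunction_mem_integral_holds` — **Greenberg–Vatsal 2000, Prop. 3.7** ("Assume … that
  `E[p]` is irreducible … Then `L(E/ℚ, χ, T) ∈ Λ`", here for trivial `χ`, `p` odd and good
  ordinary, with the period `Ω⁺_f` of the newform `f` of `E`): the named fact
  `padicLFunction_mem_integral` of `PAdicLFunction`, by `padicLFunction_mem_integral_of`
  (`PAdicLFunctionIntegralityProofs`: Manin's trick `(a_ℓ - ℓ - 1){∞, 0} ∈ Λ_f`, `p`-integrality of
  `[a/pⁿ]⁺`, the `ℤ_p`-valued measure and the Riemann sums) fed with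
  `not_irreducible_of_frobeniusTrace_congr_holds`.

## References

* R. Greenberg, V. Vatsal, *On the Iwasawa invariants of elliptic curves*, Invent. Math. 142
  (2000), Prop. 3.7 (PDF p. 62). [GreenbergVatsal2000]
* H. Darmon, F. Diamond, R. Taylor, *Fermat's Last Theorem*, Current Developments in Mathematics
  1995, Prop. 2.6(b), 2.8(a), 2.11(a). [DarmonDiamondTaylor1995]
* N. M. Katz, *Galois properties of torsion points on abelian varieties*, Invent. Math. 62 (1981),
  Thm. 2 (case `m = p`).
* J. H. Silverman, *The Arithmetic of Elliptic Curves*, 2nd ed., Springer 2009, Prop. VII.3.1(b),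
  Prop. VII.4.1(a), Cor. III.6.4(b). [SilvermanAEC2009]
* D. A. Marcus, *Number Fields*, 2nd ed. (2018), Ch. 7, Exercise 12 (f) (Frobenius Density
  Theorem). [Marcus2018]

## Design

Theorems only, `namespace Literature`; axioms of every theorem: `propext`, `Classical.choice`,
`Quot.sound`.
-/

open NumberField IsDedekindDomain Field WeierstrassCurve

namespace Literature.NumberTheory.EllipticCurves

/-- **A `Γ_ℚ`-module `E[p]` all of whose elements have a non-zero fixed point is reducible**:
if every `σ ∈ Γ_ℚ` fixes some `P ∈ E[p] ∖ {O}` then `E[p]` has a `Γ_ℚ`-stable subgroup other than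
`⊥` and `⊤` — `E[p]` is an `𝔽_p`-plane (`#E[p] = p²`, Silverman III.6.4(b)) and a subgroup of
`GL₂(𝔽_p)` in which every element has the eigenvalue `1` fixes a line
(`Representation.exists_stable_addSubgroup_of_natCard_eq_sq`). [folklore] -/
theorem not_irreducible_of_forall_exists_smul_eq (W : WeierstrassCurve ℚ) [W.IsElliptic] (p : ℕ)
    [Fact p.Prime]
    (hfix : ∀ σ : absoluteGaloisGroup ℚ, ∃ P : W.geomTorsion p, P ≠ 0 ∧ σ • P = P) :
    ¬ W.HasIrreducibleModPGaloisRep p := by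
  intro hirr
  classical
  have hp : p.Prime := Fact.out
  letI : Module (ZMod p) (W.geomTorsion p) := AddSubgroup.torsionBy.zmodModule
  have hcard : Nat.card (W.geomTorsion p) = p ^ 2 :=
    card_torsionPoints_eq_sq_holds W (AlgebraicClosure ℚ) (n := p) (by exact_mod_cast hp.ne_zero)
  obtain ⟨H, hH, hbot, htop⟩ := Literature.RepresentationTheory.FiniteGroups.Representation.exists_stable_addSubgroup_of_natCard_eq_sq hcard hfix
  rcases hirr H hH with h | h
  · exact hbot h
  · exact htop h

/-- **`E[p]` is reducible when all good Frobenius traces are Eisenstein mod `p` — discharge of the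
named fact `not_irreducible_of_frobeniusTrace_congr`** (Darmon–Diamond–Taylor 1995, Prop. 2.6(b);
Katz 1981, Thm. 2).  If `p ∣ a_ℓ(E) - ℓ - 1`, i.e. `p ∣ #Ẽ(𝔽_ℓ)`, for all good `ℓ ≠ p`, then
every `σ ∈ Γ_ℚ` fixes a non-zero point of `E[p]`: by Frobenius' density theorem (division form,
`exists_frobenius_pow_smul_eq_geomTorsion`) `σ` acts on `E[p]` as a power `φ^j` of an arithmetic
Frobenius `φ` above a good prime `ℓ ∉ {p} ∪ {ℓ ∣ Δ_min}`, and `φ` fixes a non-zero `P ∈ E[p]` by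
the reduction of torsion (`exists_frobenius_smul_eq_of_dvd_reductionPointCount_holds`, Silverman
VII.3.1(b)); conclude with `not_irreducible_of_forall_exists_smul_eq`.
[cite: DarmonDiamondTaylor1995, Prop. 2.6(b) (PDF p. 53)] -/
theorem not_irreducible_of_frobeniusTrace_congr_holds : not_irreducible_of_frobeniusTrace_congr := by
  intro W _ _ p _ hcongr
  classical
  have hp : p.Prime := Fact.out
  -- the excluded primes: `p` and the divisors of the minimal discriminant
  have hΔ0 : minimalDiscriminantInt W ≠ 0 := minimalDiscriminantInt_ne_zero W
  let S : Set ℕ := {ℓ | ℓ = p ∨ (ℓ : ℤ) ∣ minimalDiscriminantInt W}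
  have hS : S.Finite := by
    refine (Set.finite_le_nat (max p (minimalDiscriminantInt W).natAbs)).subset ?_
    rintro ℓ (rfl | hℓ)
    · exact Set.mem_setOf.mpr (le_max_left _ _)
    · exact Set.mem_setOf.mpr (le_max_of_le_right
        (Nat.le_of_dvd (Int.natAbs_pos.mpr hΔ0) (Int.natCast_dvd.mp hℓ)))
  -- every `σ ∈ Γ_ℚ` fixes a non-zero point of `E[p]`
  refine not_irreducible_of_forall_exists_smul_eq W p fun σ ↦ ?_
  obtain ⟨ℓ, v, 𝔓, φ, hℓ, hℓS, hv, h𝔓, hφ, j, hagree⟩ :=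
    exists_frobenius_pow_smul_eq_geomTorsion W (n := p) (by exact_mod_cast hp.ne_zero) S hS σ
  haveI : Fact ℓ.Prime := ⟨hℓ⟩
  have hℓp : ℓ ≠ p := fun h ↦ hℓS (Or.inl h)
  have hℓΔ : ¬ (ℓ : ℤ) ∣ minimalDiscriminantInt W := fun h ↦ hℓS (Or.inr h)
  have hgood : W.HasGoodReductionAtPrime ℓ := hasGoodReductionAtPrime_of_not_dvd W ℓ hℓΔ
  have hdvd : p ∣ W.reductionPointCount ℓ :=
    (dvd_frobeniusTrace_sub_iff W p ℓ).mp (hcongr ℓ hℓp hgood)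
  obtain ⟨P, hP0, hP⟩ :=
    exists_frobenius_smul_eq_of_dvd_reductionPointCount_holds W p ℓ hℓp hgood hdvd v hv 𝔓 h𝔓 φ hφ
  -- `φ • P = P`, hence `φ ^ j • P = P`, i.e. `σ • P = P`
  refine ⟨P, hP0, ?_⟩
  rw [hagree P]
  exact MulAction.mem_stabilizer_iff.mp
    (Subgroup.pow_mem (MulAction.stabilizer (absoluteGaloisGroup ℚ) P)
      (MulAction.mem_stabilizer_iff.mpr hP) j)

/-- **Greenberg–Vatsal 2000, Prop. 3.7 — integrality of `L_p(E, T)` for `E[p]` irreducible;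
discharge of the named fact `padicLFunction_mem_integral`** ("Assume … that `E[p]` is irreducible
… Then `L(E/ℚ, χ, T) ∈ Λ`"; here `χ` trivial, `p` odd and good ordinary, `f` the newform of the
globally minimal `E = W`, `α` the unit root: all coefficients of `L_p(E, T) = L_p(f, α, T)` lie in
`ℤ_p`).  By `padicLFunction_mem_integral_of` (`PAdicLFunctionIntegralityProofs`: the Eisenstein
multiple `(a_ℓ - ℓ - 1){∞, 0} ∈ Λ_f` from Manin's relations and the Hecke action, `p`-integrality of
`[a/pⁿ]⁺`, the `ℤ_p`-valued measure, convergence of the Riemann sums) it remains to know that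
`E[p]` irreducible forces a good `ℓ ≠ p` with `p ∤ a_ℓ - ℓ - 1`, which is
`not_irreducible_of_frobeniusTrace_congr_holds` (Frobenius' density theorem, reduction of torsion,
the invariant line of a plane representation with eigenvalue `1` everywhere).  The printed proof
(Manin constant of the optimal parametrisation, Stevens' integrality) is thus replaced, for the
period `Ω⁺_f`, by an elementary route. [cite: GreenbergVatsal2000, Prop. 3.7 (PDF p. 62)] -/
theorem padicLFunction_mem_integral_holds {N : ℕ} [NeZero N]
    {f : CuspForm (CongruenceSubgroup.Gamma0 N) 2} {p : ℕ} [Fact p.Prime] {W : WeierstrassCurve ℚ}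
    [W.IsElliptic] [W.IsGloballyMinimal] :
    padicLFunction_mem_integral (f := f) (p := p) (W := W) :=
  padicLFunction_mem_integral_of not_irreducible_of_frobeniusTrace_congr_holds

end Literature.NumberTheory.EllipticCurves
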